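import Literature.Geometry.Kaehler.LocalForms
import Literature.Geometry.Kaehler.PoincareLemmaStarConvex
import HarnessLib

/-!
# Chart transport of local forms and the Poincaré lemma on chart-convex open sets

Support for the finite-dimensionality of de Rham cohomology
(`Literature.AlgebraicGeometry.Motives.finite_deRhamCohomology`; Mayer–Vietoris route).

On a boundaryless `C^∞` manifold `M` with model space `E`, fix a point `p` and its extended chart
`e = extChartAt I p`. For a subset `C` of the chart target, the **chart set**
`chartSet I p C = e.source ∩ e ⁻¹' C` is the copy of `C` inside `M`. Forms on `chartSet I p C`
(in the sense of `Literature.Geometry.Kaehler.LocalForms`: smooth at its points, zero elsewhere)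
correspond to forms on `C ⊆ E`: `α ↦ α.inChart p` one way (`contDiffOn_inChart_of_mem_smoothFormsOn`,
with `(dα).inChart p = d (α.inChart p)` on `C`, `inChart_mextDeriv_eq_extDeriv_of_mem`), and the
pull-back `MForm.ofChartOn p W γ` the other way (`inChart_ofChartOn`, `ofChartOn_mem_smoothFormsOn`,
`mextDeriv_ofChartOn_apply`); a form on the chart set is determined by its representative
(`MForm.apply_symm_eq_of_inChart_eq`). Transporting the flat Poincaré lemma of
`Literature.Geometry.Kaehler.PoincareLemmaFlat` gives: on a chart set of an open CONVEX `C`,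
closed forms of positive degree are exact (`localClosedForms_chartSet_le_localExactForms`) and
closed `0`-forms are determined by one value (`inChart_apply_eq_of_mem_localClosedForms_zero`),
so the local de Rham cohomology of a chart-convex set is finite-dimensional in every degree
(`finite_localDeRham_chartSet`: zero in positive degree, at most `dim F` in degree `0`).

## References

* J. M. Lee, *Introduction to Smooth Manifolds*, 2nd ed. (2013), Thm. 17.14 and Cor. 17.15
  (Poincaré lemma; every point has a neighbourhood on which closed forms are exact), Prop. 17.6.
* R. Bott, L. W. Tu, *Differential Forms in Algebraic Topology* (1982), Cor. 4.1.1, §I.5.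
-/

noncomputable section

open scoped Manifold ContDiff Topology
open Bundle Set Filter

namespace Literature.Geometry.Kaehler

variable {E : Type*} [NormedAddCommGroup E] [NormedSpace ℝ E]
  {H : Type*} [TopologicalSpace H] (I : ModelWithCorners ℝ E H)
  {M : Type*} [TopologicalSpace M] [ChartedSpace H M]
  {F : Type*} [NormedAddCommGroup F] [NormedSpace ℝ F] {k : ℕ}

/-! ### Chart sets -/

/-- The **chart set** of `C ⊆ E` at `p`: the points of the source of the extended chart at `p`
that are mapped into `C`, i.e. the copy `e.symm '' C` of `C ∩ e.target` inside `M`. [folklore] -/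
def chartSet (p : M) (C : Set E) : Set M := (extChartAt I p).source ∩ extChartAt I p ⁻¹' C

variable {I} in
/-- Membership in a chart set. [folklore] -/
theorem mem_chartSet_iff {p : M} {C : Set E} {x : M} :
    x ∈ chartSet I p C ↔ x ∈ (extChartAt I p).source ∧ extChartAt I p x ∈ C :=
  Iff.rfl

/-- Chart sets of open sets are open. [folklore] -/
theorem isOpen_chartSet (p : M) {C : Set E} (hC : IsOpen C) : IsOpen (chartSet I p C) :=
  (continuousOn_extChartAt p).isOpen_inter_preimage (isOpen_extChartAt_source p) hC

/-- Chart sets commute with intersections. [folklore] -/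
theorem chartSet_inter (p : M) (C₁ C₂ : Set E) :
    chartSet I p C₁ ∩ chartSet I p C₂ = chartSet I p (C₁ ∩ C₂) := by
  ext x
  simp only [mem_inter_iff, mem_chartSet_iff]
  tauto

/-- Chart sets are monotone. [folklore] -/
theorem chartSet_mono (p : M) {C₁ C₂ : Set E} (h : C₁ ⊆ C₂) : chartSet I p C₁ ⊆ chartSet I p C₂ :=
  fun _ hx ↦ ⟨hx.1, h hx.2⟩

/-- The chart set of the empty set is empty. [folklore] -/
@[simp]
theorem chartSet_empty (p : M) : chartSet I p (∅ : Set E) = ∅ := by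
  simp [chartSet]

variable {I} in
/-- The inverse chart maps `C ⊆ e.target` into the chart set of `C`. [folklore] -/
theorem symm_mem_chartSet {p : M} {C : Set E} (hCT : C ⊆ (extChartAt I p).target) {y : E}
    (hy : y ∈ C) : (extChartAt I p).symm y ∈ chartSet I p C :=
  ⟨(extChartAt I p).map_target (hCT hy), by
    rw [mem_preimage, (extChartAt I p).right_inv (hCT hy)]; exact hy⟩

/-- Chart sets lie in the chart source. [folklore] -/
theorem chartSet_subset_source (p : M) (C : Set E) : chartSet I p C ⊆ (extChartAt I p).source :=
  inter_subset_left

/-! ### Forms on a chart set and their representatives -/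

section Transport

variable {I} [IsManifold I ∞ M]

/-- **A form is determined on the chart source by its representative**: if two forms have the
same representative in the chart at `p` at a point `y` of the target, they agree at
`e.symm y` (the tangent coordinate change in `MForm.inChart_eq_of_mem_target` is invertible, by
the cocycle identity). [folklore] -/
theorem MForm.apply_symm_eq_of_inChart_eq {p : M} {α β : MForm I M F k} {y : E}
    (hy : y ∈ (extChartAt I p).target) (h : α.inChart p y = β.inChart p y) :
    α ((extChartAt I p).symm y) = β ((extChartAt I p).symm y) := by
  set z := (extChartAt I p).symm y with hz
  have hzs : z ∈ (extChartAt I p).source := (extChartAt I p).map_target hy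
  have key : ∀ γ : MForm I M F k,
      (γ.inChart p y).compContinuousLinearMap (tangentCoordChange I z p z :) = γ z := by
    intro γ
    rw [γ.inChart_eq_of_mem_target hy, ← hz]
    ext v
    simp only [ContinuousAlternatingMap.compContinuousLinearMap_apply, Function.comp_def]
    have h1 : ∀ w : E, tangentCoordChange I p z z (tangentCoordChange I z p z w) = w := fun w ↦ by
      rw [tangentCoordChange_comp ⟨⟨mem_extChartAt_source z, hzs⟩, mem_extChartAt_source z⟩]
      exact tangentCoordChange_self (mem_extChartAt_source z)
    exact congrArg (γ z) (funext fun i ↦ h1 (v i))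
  rw [← key α, ← key β, h]

/-- A form vanishing at `e.symm y` has vanishing representative at `y`. [folklore] -/
theorem MForm.inChart_eq_zero_of_apply_eq_zero {p : M} {α : MForm I M F k} {y : E}
    (hy : y ∈ (extChartAt I p).target) (h : α ((extChartAt I p).symm y) = 0) :
    α.inChart p y = 0 := by
  rw [α.inChart_eq_of_mem_target hy, h]
  rfl

variable [I.Boundaryless]

/-- On a boundaryless manifold, smoothness of a form at a point `z` of the source of the chart
at `p` is `ContDiffAt` of its representative at `e z`. [folklore] -/
theorem MForm.smoothAt_iff_contDiffAt_inChart {p : M} {α : MForm I M F k} {z : M}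
    (hz : z ∈ (extChartAt I p).source) :
    α.SmoothAt z ↔ ContDiffAt ℝ ∞ (α.inChart p) (extChartAt I p z) := by
  rw [α.smoothAt_iff_contDiffWithinAt_inChart hz, ModelWithCorners.range_eq_univ,
    contDiffWithinAt_univ]

/-- **The representative of a form on a chart set is smooth on the chart**: for
`C ⊆ e.target` and `α` a form on `chartSet I p C`, `α.inChart p` is `C^∞` on `C`. [folklore] -/
theorem contDiffOn_inChart_of_mem_smoothFormsOn {p : M} {C : Set E} (hCT : C ⊆ (extChartAt I p).target)
    {α : MForm I M F k} (hα : α ∈ smoothFormsOn I F (chartSet I p C) k) :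
    ContDiffOn ℝ ∞ (α.inChart p) C := by
  intro y hy
  have hz := symm_mem_chartSet hCT hy
  have h := (MForm.smoothAt_iff_contDiffAt_inChart hz.1).1 (hα.1 _ hz)
  rw [(extChartAt I p).right_inv (hCT hy)] at h
  exact h.contDiffWithinAt

/-- **The representative of `dα` is `d` of the representative** at the points of `C`, for a
form `α` on `chartSet I p C` with `C ⊆ e.target` (whole-chart formula of
`ManifoldFormsChart`, boundaryless case). [folklore] -/
theorem inChart_mextDeriv_eq_extDeriv_of_mem {p : M} {C : Set E} (hCT : C ⊆ (extChartAt I p).target)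
    {α : MForm I M F k} (hα : α ∈ smoothFormsOn I F (chartSet I p C) k) {y : E} (hy : y ∈ C) :
    (mextDeriv α).inChart p y = extDeriv (α.inChart p) y := by
  rw [inChart_mextDeriv_of_mem_target α (hCT hy) (hα.1 _ (symm_mem_chartSet hCT hy)),
    ModelWithCorners.range_eq_univ, extDerivWithin_univ]

/-- For a closed form on a chart set, the representative is closed on `C`. [folklore] -/
theorem extDeriv_inChart_eq_zero_of_mem_localClosedForms {p : M} {C : Set E}
    (hCT : C ⊆ (extChartAt I p).target) {α : MForm I M F k}
    (hα : α ∈ localClosedForms I F k (chartSet I p C)) {y : E} (hy : y ∈ C) :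
    extDeriv (α.inChart p) y = 0 := by
  rw [← inChart_mextDeriv_eq_extDeriv_of_mem hCT hα.1 hy]
  exact MForm.inChart_eq_zero_of_apply_eq_zero (hCT hy) (hα.2 _ (symm_mem_chartSet hCT hy))

open Classical in
/-- **Pull-back of chart data, restricted to `W`**: the form on `M` equal on `W` (a subset of
the chart source at `p`) to `x ↦ γ (e x) ∘ tangentCoordChange I x p x` and to `0` off `W`
(the `F`-valued, restricted analogue of `MForm.ofChart` of `FormIntegrationCharts`; the value is
built in `E [⋀^Fin k]→L[ℝ] F` and transported along `TangentSpace I x = E`). [folklore] -/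
def MForm.ofChartOn (p : M) (W : Set M) (γ : E → E [⋀^Fin k]→L[ℝ] F) : MForm I M F k := fun x ↦
  (if x ∈ W then (γ (extChartAt I p x)).compContinuousLinearMap (tangentCoordChange I x p x) else 0 :
    E [⋀^Fin k]→L[ℝ] F)

omit [I.Boundaryless] in
/-- `ofChartOn` on `W`. [folklore] -/
theorem MForm.ofChartOn_apply_of_mem (p : M) {W : Set M} (γ : E → E [⋀^Fin k]→L[ℝ] F) {x : M}
    (hx : x ∈ W) (v : Fin k → E) :
    (MForm.ofChartOn p W γ : MForm I M F k) x v =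
      γ (extChartAt I p x) (fun i ↦ tangentCoordChange I x p x (v i)) := by
  simp only [MForm.ofChartOn, hx, if_true]
  rfl

omit [I.Boundaryless] in
/-- `ofChartOn` off `W`. [folklore] -/
theorem MForm.ofChartOn_apply_of_notMem (p : M) {W : Set M} (γ : E → E [⋀^Fin k]→L[ℝ] F) {x : M}
    (hx : x ∉ W) : (MForm.ofChartOn p W γ : MForm I M F k) x = 0 := by
  simp only [MForm.ofChartOn, hx, if_false]
  rfl

omit [I.Boundaryless] in
/-- **The representative of `ofChartOn p (chartSet I p C) γ` on `C` is `γ`** (cocycle identity).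
[folklore] -/
theorem MForm.inChart_ofChartOn {p : M} {C : Set E} (hCT : C ⊆ (extChartAt I p).target)
    (γ : E → E [⋀^Fin k]→L[ℝ] F) {y : E} (hy : y ∈ C) :
    (MForm.ofChartOn p (chartSet I p C) γ : MForm I M F k).inChart p y = γ y := by
  have hz := symm_mem_chartSet hCT hy
  rw [MForm.inChart_eq_of_mem_target _ (hCT hy)]
  ext v
  rw [ContinuousAlternatingMap.compContinuousLinearMap_apply,
    MForm.ofChartOn_apply_of_mem p γ hz, (extChartAt I p).right_inv (hCT hy)]
  have h1 : ∀ w : E, tangentCoordChange I ((extChartAt I p).symm y) p ((extChartAt I p).symm y)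
      (tangentCoordChange I p ((extChartAt I p).symm y) ((extChartAt I p).symm y) w) = w :=
    fun w ↦ by
      rw [tangentCoordChange_comp ⟨⟨hz.1, mem_extChartAt_source _⟩, hz.1⟩]
      exact tangentCoordChange_self hz.1
  exact congrArg (γ y) (funext fun i ↦ h1 (v i))

omit [I.Boundaryless] in
/-- Near a point of an open `C ⊆ e.target`, the representative of `ofChartOn p (chartSet I p C) γ`
agrees with `γ`. [folklore] -/
theorem MForm.inChart_ofChartOn_eventuallyEq {p : M} {C : Set E} (hC : IsOpen C)
    (hCT : C ⊆ (extChartAt I p).target) (γ : E → E [⋀^Fin k]→L[ℝ] F) {y : E} (hy : y ∈ C) :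
    (MForm.ofChartOn p (chartSet I p C) γ : MForm I M F k).inChart p =ᶠ[𝓝 y] γ := by
  filter_upwards [hC.mem_nhds hy] with w hw
  exact MForm.inChart_ofChartOn hCT γ hw

/-- **`ofChartOn` of a form smooth on `C` is a form on the chart set of `C`.** [folklore] -/
theorem ofChartOn_mem_smoothFormsOn {p : M} {C : Set E} (hC : IsOpen C)
    (hCT : C ⊆ (extChartAt I p).target) {γ : E → E [⋀^Fin k]→L[ℝ] F} (hγ : ContDiffOn ℝ ∞ γ C) :
    (MForm.ofChartOn p (chartSet I p C) γ : MForm I M F k) ∈ smoothFormsOn I F (chartSet I p C) k := by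
  refine ⟨fun x hx ↦ ?_, fun x hx ↦ MForm.ofChartOn_apply_of_notMem p γ hx⟩
  rw [MForm.smoothAt_iff_contDiffAt_inChart hx.1]
  exact (hγ.contDiffAt (hC.mem_nhds hx.2)).congr_of_eventuallyEq
    (MForm.inChart_ofChartOn_eventuallyEq hC hCT γ hx.2)

/-- **`d (ofChartOn γ) = (dγ)` read through the chart**: at a point `x` of the chart set,
`d (ofChartOn p _ γ) x` has representative `extDeriv γ (e x)`. [folklore] -/
theorem inChart_mextDeriv_ofChartOn {p : M} {C : Set E} (hC : IsOpen C)
    (hCT : C ⊆ (extChartAt I p).target) {γ : E → E [⋀^Fin k]→L[ℝ] F} (hγ : ContDiffOn ℝ ∞ γ C)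
    {y : E} (hy : y ∈ C) :
    (mextDeriv (MForm.ofChartOn p (chartSet I p C) γ : MForm I M F k)).inChart p y = extDeriv γ y := by
  rw [inChart_mextDeriv_eq_extDeriv_of_mem hCT (ofChartOn_mem_smoothFormsOn hC hCT hγ) hy]
  exact (MForm.inChart_ofChartOn_eventuallyEq hC hCT γ hy).extDeriv_eq

/-! ### The Poincaré lemma on chart-convex sets -/

variable [FiniteDimensional ℝ E] [CompleteSpace F]

/-- **Poincaré lemma on chart-convex sets, positive degree**: on the chart set of an open
convex `C ⊆ e.target`, every closed `(k+1)`-form is exact: it is `d_W` of the transported cone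
transform `ofChartOn p W (K (α.inChart p))`. Lee (2013), Thm. 17.14 / Cor. 17.15.
[cite: LeeSmoothManifolds2013, Thm. 17.14] -/
theorem localClosedForms_chartSet_le_localExactForms (p : M) {C : Set E} (hC : IsOpen C)
    (hCc : Convex ℝ C) (hCT : C ⊆ (extChartAt I p).target) :
    localClosedForms I F (k + 1) (chartSet I p C) ≤
      localExactForms I F (isOpen_chartSet I p hC) (k + 1) := by
  intro α hα
  rcases C.eq_empty_or_nonempty with rfl | ⟨c₀, hc₀⟩
  · have h0 : α = 0 := funext fun x ↦ hα.1.2 x (by simp)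
    rw [h0]
    exact Submodule.zero_mem _
  have hst : StarConvex ℝ c₀ C := hCc.starConvex hc₀
  set η : E → E [⋀^Fin (k + 1)]→L[ℝ] F := α.inChart p with hη
  have hηs : ContDiffOn ℝ ∞ η C := contDiffOn_inChart_of_mem_smoothFormsOn hCT hα.1
  have hηd : ∀ y ∈ C, extDeriv η y = 0 := fun y hy ↦
    extDeriv_inChart_eq_zero_of_mem_localClosedForms hCT hα hy
  set γ : E → E [⋀^Fin k]→L[ℝ] F := coneOperator c₀ η with hγ
  have hγs : ContDiffOn ℝ ∞ γ C := contDiffOn_coneOperator hC hst hηs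
  have hγd : ∀ y ∈ C, extDeriv γ y = η y := fun y hy ↦
    extDeriv_coneOperator_of_extDeriv_eq_zero hC hst hηs hηd hy
  set β : smoothFormsOn I F (chartSet I p C) k :=
    ⟨MForm.ofChartOn p (chartSet I p C) γ, ofChartOn_mem_smoothFormsOn hC hCT hγs⟩ with hβ
  refine (mem_localExactForms_succ_iff (isOpen_chartSet I p hC)).2 ⟨β, funext fun x ↦ ?_⟩
  by_cases hx : x ∈ chartSet I p C
  · rw [localD_apply_of_mem _ _ hx]
    have hx' : (extChartAt I p).symm (extChartAt I p x) = x := (extChartAt I p).left_inv hx.1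
    have key : (mextDeriv (β : MForm I M F k)).inChart p (extChartAt I p x) =
        α.inChart p (extChartAt I p x) := by
      rw [hβ]
      change (mextDeriv (MForm.ofChartOn p (chartSet I p C) γ : MForm I M F k)).inChart p _ = _
      rw [inChart_mextDeriv_ofChartOn hC hCT hγs hx.2, hγd _ hx.2]
    have := MForm.apply_symm_eq_of_inChart_eq ((extChartAt I p).map_source hx.1) key
    rwa [hx'] at this
  · rw [coe_localD, MForm.restr_apply_of_notMem _ hx, hα.1.2 x hx]

omit [FiniteDimensional ℝ E] [CompleteSpace F] in
/-- **Closed `0`-forms on a chart-convex set are constant in the chart**: their representative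
takes one value on `C`. Lee (2013), Prop. 17.6. [cite: LeeSmoothManifolds2013, Prop. 17.6] -/
theorem inChart_apply_eq_of_mem_localClosedForms_zero (p : M) {C : Set E} (hC : IsOpen C)
    (hCc : Convex ℝ C) (hCT : C ⊆ (extChartAt I p).target) {α : MForm I M F 0}
    (hα : α ∈ localClosedForms I F 0 (chartSet I p C)) {c₀ y : E} (hc₀ : c₀ ∈ C) (hy : y ∈ C) :
    α.inChart p y = α.inChart p c₀ :=
  eq_of_extDeriv_eq_zero_of_starConvex hC (hCc.starConvex hc₀)
    ((contDiffOn_inChart_of_mem_smoothFormsOn hCT hα.1).differentiableOn (by simp))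
    (fun _ hw ↦ extDeriv_inChart_eq_zero_of_mem_localClosedForms hCT hα hw) hy

omit [FiniteDimensional ℝ E] [CompleteSpace F] in
/-- On a chart-convex set, evaluation of the representative at one point `c₀ ∈ C` is injective
on closed `0`-forms. [folklore] -/
theorem eq_of_inChart_apply_eq_of_mem_localClosedForms_zero (p : M) {C : Set E} (hC : IsOpen C)
    (hCc : Convex ℝ C) (hCT : C ⊆ (extChartAt I p).target) {α β : MForm I M F 0}
    (hα : α ∈ localClosedForms I F 0 (chartSet I p C)) (hβ : β ∈ localClosedForms I F 0 (chartSet I p C))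
    {c₀ : E} (hc₀ : c₀ ∈ C) (h : α.inChart p c₀ = β.inChart p c₀) : α = β := by
  funext x
  by_cases hx : x ∈ chartSet I p C
  · have hx' : (extChartAt I p).symm (extChartAt I p x) = x := (extChartAt I p).left_inv hx.1
    have key : α.inChart p (extChartAt I p x) = β.inChart p (extChartAt I p x) := by
      rw [inChart_apply_eq_of_mem_localClosedForms_zero p hC hCc hCT hα hc₀ hx.2,
        inChart_apply_eq_of_mem_localClosedForms_zero p hC hCc hCT hβ hc₀ hx.2, h]
    have := MForm.apply_symm_eq_of_inChart_eq ((extChartAt I p).map_source hx.1) key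
    rwa [hx'] at this
  · rw [hα.1.2 x hx, hβ.1.2 x hx]

/-- **The de Rham cohomology of a chart-convex set is finite-dimensional** in every degree
(zero in positive degree by the Poincaré lemma; in degree `0` it embeds in the
finite-dimensional coefficient space `F`, closed `0`-forms being determined by one value).
Bott–Tu (1982), §I.5 (the start of the Mayer–Vietoris induction). [cite: BottTu1982Forms, §I.5] -/
theorem finite_localDeRham_chartSet [FiniteDimensional ℝ F] (p : M) {C : Set E} (hC : IsOpen C)
    (hCc : Convex ℝ C) (hCT : C ⊆ (extChartAt I p).target) (k : ℕ) :
    Module.Finite ℝ (LocalDeRham I F k (isOpen_chartSet I p hC)) := by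
  cases k with
  | succ k =>
    -- every class is zero
    have h : ∀ c : LocalDeRham I F (k + 1) (isOpen_chartSet I p hC), c = 0 := by
      intro c
      obtain ⟨α, rfl⟩ := LocalDeRham.mk_surjective _ c
      rw [LocalDeRham.mk_eq_zero_iff]
      exact localClosedForms_chartSet_le_localExactForms p hC hCc hCT α.2
    haveI : Subsingleton (LocalDeRham I F (k + 1) (isOpen_chartSet I p hC)) :=
      ⟨fun a b ↦ by rw [h a, h b]⟩
    exact Module.Finite.of_finite
  | zero =>
    rcases C.eq_empty_or_nonempty with hCe | ⟨c₀, hc₀⟩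
    · -- empty chart set: everything vanishes
      have h : ∀ c : LocalDeRham I F 0 (isOpen_chartSet I p hC), c = 0 := by
        intro c
        obtain ⟨α, rfl⟩ := LocalDeRham.mk_surjective _ c
        have h0 : (α : MForm I M F 0) = 0 := funext fun x ↦ α.2.1.2 x (by
          rw [hCe, chartSet_empty]; exact notMem_empty x)
        have : α = 0 := Subtype.ext h0
        rw [this, _root_.map_zero]
      haveI : Subsingleton (LocalDeRham I F 0 (isOpen_chartSet I p hC)) :=
        ⟨fun a b ↦ by rw [h a, h b]⟩
      exact Module.Finite.of_finite
    · -- evaluation of the representative at `c₀` is an injective linear map to `E [⋀^Fin 0]→L F`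
      haveI : Module.Finite ℝ (E [⋀^Fin 0]→L[ℝ] F) :=
        Module.Finite.equiv (ContinuousAlternatingMap.constOfIsEmptyLIE ℝ E F (Fin 0)).toLinearEquiv
      let ev : localClosedForms I F 0 (chartSet I p C) →ₗ[ℝ] (E [⋀^Fin 0]→L[ℝ] F) :=
        { toFun := fun α ↦ (α : MForm I M F 0).inChart p c₀
          map_add' := fun α β ↦ by simp [MForm.inChart_add]
          map_smul' := fun c α ↦ by simp [MForm.inChart_smul] }
      have hev : Function.Injective ev := fun α β h ↦
        Subtype.ext (eq_of_inChart_apply_eq_of_mem_localClosedForms_zero p hC hCc hCT α.2 β.2 hc₀ h)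
      haveI : Module.Finite ℝ (localClosedForms I F 0 (chartSet I p C)) :=
        Module.Finite.of_injective ev hev
      exact Module.Finite.of_surjective _ (LocalDeRham.mk_surjective _)

end Transport

end Literature.Geometry.Kaehler
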